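import Literature.MathematicalPhysics.QuantumFieldTheory.Balaban1983to89.B9Eq353FormDefectTowerTwoBackgrounds

/-!
# `Balaban1983to89.B9Eq386GreenkLipschitzEnergyTwoBackgrounds` — T. Bałaban, *Propagators for lattice gauge theories in a background field*, Commun. Math. Phys.
# **99** (1985) 389–434 [Balaban1985BackgroundPropagators] Thm 3.4 p. 400 with (3.84)–(3.86) p. 407 AT `k = n+1` AVERAGING LEVELS ON PRINT's DIAGONAL, BETWEEN
# TWO SMALL BACKGROUNDS: **`‖G_k(U)y − G_k(V)y‖_{N₁} ≤ C·δ·‖y‖` WITH `C` FREE OF `η`, THE VOLUME AND THE NUMBER OF LEVELS** — the two-background («(b3)») twin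
# of the NE9 owner's 4b `B9Eq386GreenkLipschitzEnergyDiagonal` (there `V = 1`, `δ = α`): the energy-norm perturbation argument of this lineage's abstract
# `B9Eq386GreenLipschitzEnergy` (`weight_green_le`, `weight_green_sub_le_of_bound`) fed with INTENT-7's two-background form defect
# `B9Eq353FormDefectTowerTwoBackgrounds` and the strong coercivities at `U` AND at `V` in the FLAT weight (`B9Eq3153FrakGkBoundDiagonal` §1 twice)

statement-level skeleton of published theorems with citation tags; proofs where landed; nothing here is a claim about the Yang–Mills mass gap

PDF held: `paper:balaban1985-cmp99-background-propagators` (journal page = PDF page + 388), pp. 400, 407 through the suppliers' quotations.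

CITATION HEADER (lean-in-tree rule 2026-08-18).  Audit cell `pub-balaban`, sub-cell `t4`, NE9 crux team (2): LEAF PROVER 04 (`b2b-balaban-t4-ne9-formalise-leaf-04`
gen 77), INTENT-8.  WHY: (3.86)'s `|G_k(U) − G_k(V)|` between two histories of the NE9 chain at one level is what the two-background `H_{1,k}` ∕ `𝔊_k` ∕ (117)
storeys consume; the owner's 4b gives it only against the flat background.

THE PRINT.  (3.86) p. 407: the Green's function is Lipschitz in the background; Thm 3.4 p. 400: `G_k(U)` exists with `L²` and energy bounds uniform in the
lattice; (3.52)–(3.53) p. 400: `Δ_{U′U} = Δ_U − V₁(A)`.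

WHAT IS PROVED (sorry-free; 0 `def`; [folklore] composition BY NAME; nothing of [B9] asserted as printed).
* **`exists_norm_G1k_sub_G1k_le_two_backgrounds_closed`** — `∃ α₀ δ₀ C > 0` (`C = Θ̄₂∕γ₁²`, closed in `(d, a, L, M_φ, M_φ′, r, C_τ, ρ_w, C_R^{(2)})`) BEFORE the
  binders of `B9Eq353FormDefectTowerTwoBackgrounds.exists_form_defect_two_backgrounds_diagonal_closed` + the plaquette window of `V`, then for ANY positivity
  witnesses of `Δ^{(n+1)}_a(U)`, `Δ^{(n+1)}_a(V)` and every `y`: `‖G_k(U)y − G_k(V)y‖, ‖curl₁(G_k(U)y − G_k(V)y)‖, ‖div₁(G_k(U)y − G_k(V)y)‖ ≤ C·δ·‖y‖`,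
  `G_k(X)y = B11Eq103H1Complex.greenK (Δ^{(n+1)}_a(X)) hposX y`.
MODEL ∕ DECLARED READINGS.  Those of `B9Eq353FormDefectTowerTwoBackgrounds` (every window ∕ profile ∕ closeness letter and `C_R^{(2)}` DISPLAYED) and of the
owner's 4b (positivity witnesses as binders; `greenK` spelling).
HONEST SCOPE.  FIRST order between two small backgrounds on the diagonal ONLY (no analyticity, no Neumann series); Thm 3.4's decay NOT here; no kernel bound.
NOT summit progress (cell pub-balaban: NE9 NOT PRINTED ∕ NOT PROVED; «NE9 ⇐ the named binders»; row WALLED ON A MODEL (O-NE9-1; #5 UNRULED); spine PROVED 0∕9;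
rung (B)+1 finite T⁴ — NOT infinite volume, NOT mass gap, NOT BetaPertH, NOT Clay).  HONEST DEPENDENCY (cell line): continuum YM on T⁴ ⇐ BetaPertH ∧ nine spine
estimates (0/9 proved); BetaPertH ⇐ (D1) ∧ (D4) ∧ CAP+tail; G-an2-4 gates asym, D1 and NE2/3/4.  NEW file; nothing modified.  Net new unproved facts: 0.
-/

noncomputable section

open scoped InnerProductSpace ComplexConjugate BigOperators

namespace Literature.MathematicalPhysics.QuantumFieldTheory.Balaban1983to89.B9Eq386GreenkLipschitzEnergyTwoBackgrounds

open B4Sect5Torus (TSite)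
open B9SectCLatticeCarrier (Bond)
open B11Eq103H1Complex (SiteL2K BondL2K covDivL2K)
open B9Eq310HessianOperator (adTransportW covCurlL2K)
open B9Eq310DeltaPrime (plaqHolU)
open B9Eq315QTorus (perCfg cornerSite)
open B9Eq315QTower (towerP UlevOf)
open B9Eq326OperatorTower (laplaceAk QkW RofUk)
open B7Prop1Explicit (U1 Wcx boxVec)
open B9Eq386GreenLipschitzEnergy (weight_green_le weight_green_sub_le_of_bound)
open B9Eq3153FrakGkBoundDiagonal (exists_energy_letters_diagonal_closed)
open B9Eq353FormDefectTowerTwoBackgrounds (exists_form_defect_two_backgrounds_diagonal_closed)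

/-- `x ≤ √S` from `0 ≤ x` and `x² ≤ S`. [folklore] -/
private theorem le_sqrt_of_sq_le {x S : ℝ} (hx : 0 ≤ x) (h : x ^ 2 ≤ S) : x ≤ Real.sqrt S := by
  rw [← Real.sqrt_sq hx]; exact Real.sqrt_le_sqrt h

variable {d : ℕ} (L : ℕ) [NeZero L] (hL : 1 ≤ L)
  {𝔸 : Type*} [NormedRing 𝔸] [NormedAlgebra ℂ 𝔸] [CompleteSpace 𝔸] [NormOneClass 𝔸] [StarRing 𝔸] [NormedStarGroup 𝔸] [StarModule ℂ 𝔸]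
  {W : Type*} [NormedAddCommGroup W] [InnerProductSpace ℂ W] [FiniteDimensional ℂ W] (φ : W ≃ₗ[ℂ] 𝔸)
  {Mφ Mφ' : ℝ} (hMφ : 0 ≤ Mφ) (hMφ' : 0 ≤ Mφ') (hφ : ∀ w, ‖φ w‖ ≤ Mφ * ‖w‖) (hφ' : ∀ X, ‖φ.symm X‖ ≤ Mφ' * ‖X‖)
  {a : ℝ} (ha : 0 < a) {r : ℝ} (hr0 : 0 ≤ r) (hr1 : r < 1)
  (τ : 𝔸 →ₗ[ℂ] ℂ) {Cτ : ℝ} (hτ : ∀ X, ‖τ X‖ ≤ Cτ * ‖X‖) (hCτ : 0 ≤ Cτ) {ρw : ℝ} (hρw : 0 ≤ ρw) {CR : ℝ} (hCR : 0 ≤ CR)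

include hMφ hMφ' hφ hφ' ha hr0 hr1 hτ hCτ hρw hCR

/-- **THE `k`-TH-STEP GREEN's FUNCTION IS LIPSCHITZ BETWEEN TWO SMALL BACKGROUNDS IN THE ENERGY NORM, LEVEL-FREE ON THE DIAGONAL, MODULO `C_R^{(2)}`**:
`∃ α₀ δ₀ C > 0` (closed) such that under the binders of `exists_form_defect_two_backgrounds_diagonal_closed` plus the plaquette window of `V`, for ANY positivity
witnesses of `Δ^{(n+1)}_a(U)`, `Δ^{(n+1)}_a(V)` and every `y`: `‖G_k(U)y − G_k(V)y‖, ‖curl₁(…)‖, ‖div₁(…)‖ ≤ C·δ·‖y‖` — the energy-norm perturbation argument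
(`weight_green_sub_le_of_bound`) on the two-background form defect `Θ̄₂·δ·N₁(u)N₁(v)`, the strong coercivity `γ₁` at `U` (flat weight) and the row
`N₁(G_k(V)y) ≤ γ₁⁻¹‖y‖` from the coercivity at `V`. [cite: Balaban1985BackgroundPropagators, Thm 3.4 p.400, (3.84)–(3.86) p.407, (3.52)–(3.53) p.400, (3.35) p.396] -/
theorem exists_norm_G1k_sub_G1k_le_two_backgrounds_closed :
    ∃ α₀ δ₀ C : ℝ, 0 < α₀ ∧ 0 < δ₀ ∧ 0 < C ∧ ∀ (n : ℕ) (η : ℝ), η * (L : ℝ) ^ (n + 1) = 1 →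
      ∀ (c₀ c₁ : ℝ) [Fact (0 < c₀)] [Fact (0 < c₁)], c₀ * ((L : ℝ) ^ (n + 1)) ^ d = c₁ → |η| ^ d / c₀ ≤ ρw →
      ∀ (m : Fin d → ℕ) [∀ i, NeZero (m i)] (U V : Bond d (towerP L m (n + 1)) → 𝔸ˣ) (αU : ℕ → ℝ) (hα1 : ∀ j, αU j ≤ 1 / 64)
        (hU1 : ∀ (j : ℕ) (x : B7Prop1Explicit.Site d) (κ : Fin d), perCfg (towerP L m (j + 1)) (UlevOf L m (n + 1) U j) x κ ∈ U1 𝔸)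
        (hreg : ∀ (j : ℕ) (y : TSite d (towerP L m j)) (κ : Fin d) (r : Fin d → Fin L),
          ‖((Wcx L (perCfg (towerP L m (j + 1)) (UlevOf L m (n + 1) U j)) (cornerSite L y) κ (boxVec L r) : 𝔸ˣ) : 𝔸) - 1‖ ≤ αU j)
        (αV : ℕ → ℝ) (hα1' : ∀ j, αV j ≤ 1 / 64)
        (hV1 : ∀ (j : ℕ) (x : B7Prop1Explicit.Site d) (κ : Fin d), perCfg (towerP L m (j + 1)) (UlevOf L m (n + 1) V j) x κ ∈ U1 𝔸)
        (hregV : ∀ (j : ℕ) (y : TSite d (towerP L m j)) (κ : Fin d) (r : Fin d → Fin L),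
          ‖((Wcx L (perCfg (towerP L m (j + 1)) (UlevOf L m (n + 1) V j)) (cornerSite L y) κ (boxVec L r) : 𝔸ˣ) : 𝔸) - 1‖ ≤ αV j),
        (∀ j, αV j ≤ 1 / 128) →
      ∀ (εU : ℕ → ℝ), (∀ j, 0 ≤ εU j) → (∀ (j : ℕ) (b : Bond d (towerP L m (j + 1))), ‖(UlevOf L m (n + 1) U j b : 𝔸) - 1‖ ≤ εU j) →
        (∀ (j : ℕ) (b : Bond d (towerP L m (j + 1))), ‖(UlevOf L m (n + 1) V j b : 𝔸) - 1‖ ≤ εU j) →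
      ∀ (δUV : ℕ → ℝ), (∀ j, 0 ≤ δUV j) →
        (∀ (j : ℕ) (b : Bond d (towerP L m (j + 1))), ‖(UlevOf L m (n + 1) U j b : 𝔸) - (UlevOf L m (n + 1) V j b : 𝔸)‖ ≤ δUV j) →
      ∀ {α δ : ℝ}, 0 ≤ α → α ≤ α₀ → 0 ≤ δ → δ ≤ δ₀ →
        (∀ (b : Bond d (towerP L m (n + 1))) (v u : W), ⟪adTransportW φ U b v, u⟫_ℂ = ⟪v, adTransportW φ (fun b => (U b)⁻¹) b u⟫_ℂ) →
        (∀ (b : Bond d (towerP L m (n + 1))) (v u : W), ⟪adTransportW φ V b v, u⟫_ℂ = ⟪v, adTransportW φ (fun b => (V b)⁻¹) b u⟫_ℂ) →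
        (∀ b, U b ∈ U1 𝔸) → (∀ b, V b ∈ U1 𝔸) → (∀ b, ‖(U b : 𝔸) - 1‖ ≤ α * η) → (∀ b, ‖(V b : 𝔸) - 1‖ ≤ α * η) →
        (∀ p : B9SectCLatticeCarrier.Plaq d (towerP L m (n + 1)), ‖(plaqHolU U p : 𝔸) - 1‖ ≤ α * η ^ 2) →
        (∀ p : B9SectCLatticeCarrier.Plaq d (towerP L m (n + 1)), ‖(plaqHolU V p : 𝔸) - 1‖ ≤ α * η ^ 2) →
        (∀ b, ‖(U b : 𝔸) - (V b : 𝔸)‖ ≤ δ * η) →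
        (∀ p : B9SectCLatticeCarrier.Plaq d (towerP L m (n + 1)), ‖(plaqHolU U p : 𝔸) - (plaqHolU V p : 𝔸)‖ ≤ δ * η ^ 2) →
        (∀ j < n + 1, εU j ≤ α * r ^ j) → (∀ j, δUV j ≤ δ * r ^ j) →
        (∀ s : SiteL2K ℂ d (towerP L m (n + 1)) c₀ W, ‖RofUk L m n φ η U s - RofUk L m n φ η V s‖ ≤ CR * δ * ‖s‖) →
        ∀ (hposU : ∀ x : BondL2K ℂ d (towerP L m (n + 1)) c₀ W, x ≠ 0 →
            0 < RCLike.re ⟪x, laplaceAk L m n φ η U hL αU hα1 hU1 hreg τ (c₀ := c₀) (c₁ := c₁) a x⟫_ℂ)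
          (hposV : ∀ x : BondL2K ℂ d (towerP L m (n + 1)) c₀ W, x ≠ 0 →
            0 < RCLike.re ⟪x, laplaceAk L m n φ η V hL αV hα1' hV1 hregV τ (c₀ := c₀) (c₁ := c₁) a x⟫_ℂ)
          (y : BondL2K ℂ d (towerP L m (n + 1)) c₀ W),
          ‖B11Eq103H1Complex.greenK (laplaceAk L m n φ η U hL αU hα1 hU1 hreg τ (c₀ := c₀) (c₁ := c₁) a) hposU y -
            B11Eq103H1Complex.greenK (laplaceAk L m n φ η V hL αV hα1' hV1 hregV τ (c₀ := c₀) (c₁ := c₁) a) hposV y‖ ≤ C * δ * ‖y‖ ∧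
          ‖covCurlL2K ℂ c₀ ((η : ℂ))⁻¹ (adTransportW φ (fun _ : Bond d (towerP L m (n + 1)) => (1 : 𝔸ˣ)))
            (B11Eq103H1Complex.greenK (laplaceAk L m n φ η U hL αU hα1 hU1 hreg τ (c₀ := c₀) (c₁ := c₁) a) hposU y -
            B11Eq103H1Complex.greenK (laplaceAk L m n φ η V hL αV hα1' hV1 hregV τ (c₀ := c₀) (c₁ := c₁) a) hposV y)‖ ≤ C * δ * ‖y‖ ∧
          ‖covDivL2K ℂ c₀ ((η : ℂ))⁻¹ (adTransportW φ fun _ : Bond d (towerP L m (n + 1)) => (1 : 𝔸ˣ)⁻¹)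
            (B11Eq103H1Complex.greenK (laplaceAk L m n φ η U hL αU hα1 hU1 hreg τ (c₀ := c₀) (c₁ := c₁) a) hposU y -
            B11Eq103H1Complex.greenK (laplaceAk L m n φ η V hL αV hα1' hV1 hregV τ (c₀ := c₀) (c₁ := c₁) a) hposV y)‖ ≤ C * δ * ‖y‖ := by
  obtain ⟨α₁, γ₁, hα₁, hγ₁, H1⟩ := exists_energy_letters_diagonal_closed L hL φ hMφ hMφ' hφ hφ' ha hr0 hr1 τ hτ hCτ hρw
  obtain ⟨α₂, δ₀, Θ, hα₂, hδ₀, hΘ, H2⟩ :=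
    exists_form_defect_two_backgrounds_diagonal_closed L hL φ hMφ hMφ' hφ hφ' ha hr0 hr1 τ hτ hCτ hρw hCR
  refine ⟨min α₁ α₂, δ₀, Θ / γ₁ * γ₁⁻¹, lt_min hα₁ hα₂, hδ₀, by positivity, ?_⟩
  intro n η hηL c₀ c₁ _ _ hw hρ m _ U V αU hα1 hU1 hreg αV hα1' hV1 hregV hα128 εU hεU hUε hVε δUV hδUV hLUV α δ hα0 hαle hδ0 hδle
    hRSU hRSV hUb hVb hUη hVη hplU hplV hUV hpp hεg hδg hR2 hposU hposV y
  have hαα₁ : α ≤ α₁ := hαle.trans (min_le_left _ _)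
  have hαα₂ : α ≤ α₂ := hαle.trans (min_le_right _ _)
  have HU := H1 n η hηL c₀ c₁ hw hρ m U αU hα1 hU1 hreg εU hεU hUε hα0 hαα₁ hRSU hUb hUη hplU hεg
  have HV := H1 n η hηL c₀ c₁ hw hρ m V αV hα1' hV1 hregV εU hεU hVε hα0 hαα₁ hRSV hVb hVη hplV hεg
  have HT := H2 n η hηL c₀ c₁ hw hρ m U V αU hα1 hU1 hreg αV hα1' hV1 hregV hα128 εU hεU hUε hVε δUV hδUV hLUV hα0 hαα₂ hδ0 hδle hRSU hRSV
    hUb hVb hUη hVη hplU hUV hpp hεg hδg hR2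
  have hΘδ : 0 ≤ Θ * δ := mul_nonneg hΘ.le hδ0
  obtain ⟨N, hNdef⟩ : ∃ N : BondL2K ℂ d (towerP L m (n + 1)) c₀ W → ℝ, N = fun z =>
      Real.sqrt (‖covCurlL2K ℂ c₀ ((η : ℂ))⁻¹ (adTransportW φ (fun _ : Bond d (towerP L m (n + 1)) => (1 : 𝔸ˣ))) z‖ ^ 2 + ‖covDivL2K ℂ c₀ ((η : ℂ))⁻¹ (adTransportW φ fun _ : Bond d (towerP L m (n + 1)) => (1 : 𝔸ˣ)⁻¹) z‖ ^ 2 + ‖z‖ ^ 2) := ⟨_, rfl⟩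
  have hNz : ∀ z, N z = Real.sqrt (‖covCurlL2K ℂ c₀ ((η : ℂ))⁻¹ (adTransportW φ (fun _ : Bond d (towerP L m (n + 1)) => (1 : 𝔸ˣ))) z‖ ^ 2 + ‖covDivL2K ℂ c₀ ((η : ℂ))⁻¹ (adTransportW φ fun _ : Bond d (towerP L m (n + 1)) => (1 : 𝔸ˣ)⁻¹) z‖ ^ 2 + ‖z‖ ^ 2) := fun z => by rw [hNdef]
  have hN0 : ∀ z, 0 ≤ N z := fun z => by rw [hNz]; exact Real.sqrt_nonneg _
  have hNsq : ∀ z, N z ^ 2 = ‖covCurlL2K ℂ c₀ ((η : ℂ))⁻¹ (adTransportW φ (fun _ : Bond d (towerP L m (n + 1)) => (1 : 𝔸ˣ))) z‖ ^ 2 + ‖covDivL2K ℂ c₀ ((η : ℂ))⁻¹ (adTransportW φ fun _ : Bond d (towerP L m (n + 1)) => (1 : 𝔸ˣ)⁻¹) z‖ ^ 2 + ‖z‖ ^ 2 := fun z => by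
    rw [hNz]; exact Real.sq_sqrt (add_nonneg (add_nonneg (sq_nonneg _) (sq_nonneg _)) (sq_nonneg _))
  have hNn : ∀ z, ‖z‖ ≤ N z := fun z => by
    rw [hNz]; exact le_sqrt_of_sq_le (norm_nonneg _) (le_add_of_nonneg_left (add_nonneg (sq_nonneg _) (sq_nonneg _)))
  have hNc : ∀ z, ‖covCurlL2K ℂ c₀ ((η : ℂ))⁻¹ (adTransportW φ (fun _ : Bond d (towerP L m (n + 1)) => (1 : 𝔸ˣ))) z‖ ≤ N z := fun z => by
    rw [hNz]; exact le_sqrt_of_sq_le (norm_nonneg _) ((le_add_of_nonneg_right (sq_nonneg _)).trans (le_add_of_nonneg_right (sq_nonneg _)))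
  have hNd : ∀ z, ‖covDivL2K ℂ c₀ ((η : ℂ))⁻¹ (adTransportW φ fun _ : Bond d (towerP L m (n + 1)) => (1 : 𝔸ˣ)⁻¹) z‖ ≤ N z := fun z => by
    rw [hNz]; exact le_sqrt_of_sq_le (norm_nonneg _) ((le_add_of_nonneg_left (sq_nonneg _)).trans (le_add_of_nonneg_right (sq_nonneg _)))
  have hcoerU : ∀ z, γ₁ * N z ^ 2 ≤ RCLike.re ⟪z, laplaceAk L m n φ η U hL αU hα1 hU1 hreg τ (c₀ := c₀) (c₁ := c₁) a z⟫_ℂ := fun z => by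
    rw [hNsq]; exact (HU z).1
  have hcoerV : ∀ z, γ₁ * N z ^ 2 ≤ RCLike.re ⟪z, laplaceAk L m n φ η V hL αV hα1' hV1 hregV τ (c₀ := c₀) (c₁ := c₁) a z⟫_ℂ := fun z => by
    rw [hNsq]; exact (HV z).1
  have hT : ∀ u v : BondL2K ℂ d (towerP L m (n + 1)) c₀ W, ‖⟪u, laplaceAk L m n φ η U hL αU hα1 hU1 hreg τ (c₀ := c₀) (c₁ := c₁) a v⟫_ℂ -
      ⟪u, laplaceAk L m n φ η V hL αV hα1' hV1 hregV τ (c₀ := c₀) (c₁ := c₁) a v⟫_ℂ‖ ≤ Θ * δ * N u * N v :=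
    fun u v => by rw [hNz u, hNz v]; exact HT u v
  have hGV : ∀ y, N (B11Eq103H1Complex.greenK _ hposV y) ≤ γ₁⁻¹ * ‖y‖ := fun y => weight_green_le (𝕜 := ℂ) hposV N hN0 hNn hγ₁ hcoerV y
  have hz : N (B11Eq103H1Complex.greenK _ hposV y - B11Eq103H1Complex.greenK _ hposU y) ≤ Θ * δ / γ₁ * γ₁⁻¹ * ‖y‖ :=
    weight_green_sub_le_of_bound (𝕜 := ℂ) hposV hposU N hN0 hγ₁ hΘδ hcoerU hT hGV y
  have hzB : N (B11Eq103H1Complex.greenK _ hposV y - B11Eq103H1Complex.greenK _ hposU y) ≤ Θ / γ₁ * γ₁⁻¹ * δ * ‖y‖ := by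
    rw [show Θ / γ₁ * γ₁⁻¹ * δ * ‖y‖ = Θ * δ / γ₁ * γ₁⁻¹ * ‖y‖ by ring]; exact hz
  have hneg : B11Eq103H1Complex.greenK _ hposU y - B11Eq103H1Complex.greenK _ hposV y =
      -(B11Eq103H1Complex.greenK _ hposV y - B11Eq103H1Complex.greenK _ hposU y) := (neg_sub _ _).symm
  refine ⟨?_, ?_, ?_⟩
  · rw [hneg, norm_neg]; exact (hNn _).trans hzB
  · rw [hneg, map_neg, norm_neg]; exact (hNc _).trans hzB
  · rw [hneg, map_neg, norm_neg]; exact (hNd _).trans hzB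

end Literature.MathematicalPhysics.QuantumFieldTheory.Balaban1983to89.B9Eq386GreenkLipschitzEnergyTwoBackgrounds

end
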